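import Literature.NumberTheory.PAdicHodge.LubinTateCharacterConjugatesTotallyRamified
import HarnessLib

/-!
# Hypothesis (H) of `LubinTateCharacterConjugates` for every totally ramified `F/ℚ_p`, ALL primes `p`
# (the level-two estimate `‖θ_ρ(x_t)‖ = ‖ρ − π‖·‖t₁‖`)

Topic `Literature/NumberTheory/PAdicHodge`. `LubinTateCharacterConjugatesTotallyRamified` proved the hypothesis
**(H) `LubinTateCharacterConjugateAdmissible F p hp hπ`** (every conjugate `e ∘ χ_π`, `e ≠ id`, of the Lubin–Tate
character of a totally ramified `F/ℚ_p` has a non-zero eigenvector in `ℂ_F`) under the extra hypothesis `p ≥ 3`, which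
entered at exactly one point: the *level-one* non-vanishing `ρ y₁ + y₁^q ≠ 0` of the conjugate specialisation
`y₀ = θ_ρ(x_t)` of Fontaine's element (false for `q = 2`). Here we remove it:
★★ `lubinTateCharacterConjugateAdmissible_of_finrank_eq` — (H) for every totally ramified `F/ℚ_p` and every `p`
(including `p = 2`), by going one level further up the division tower.

## The level-two estimate (§1, any ultrametric field, any `q ≥ 2`)

Let `‖ρ‖ = ‖ϖ‖ < 1`, `δ := ‖ρ − ϖ‖` (so `δ ≤ ‖ϖ‖`), and let `t₁ ≠ 0`, `t₂` be the first two layers of a `ϖ`-division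
tower of `P = ϖX + X^q`: `ϖt₁ + t₁^q = 0`, `ϖt₂ + t₂^q = t₁`. Then `‖t₁‖^{q−1} = ‖ϖ‖`, and `‖t₂‖^q = ‖t₁‖` with
`‖ϖ‖ < ‖t₂‖^{q−1}` (the `X^q`-term dominates at level two). If `‖y₂ − t₂‖ ≤ δ` and `y₁ := ρy₂ + y₂^q`,
`y₀ := ρy₁ + y₁^q` (the conjugate polynomial `P_ρ = ρX + X^q`), then
* `y₁ − t₁ = (ρ − ϖ)y₂ + ϖ(y₂ − t₂) + (y₂^q − t₂^q)` has norm `≤ δ‖t₂‖` (so `‖y₁‖ = ‖t₁‖`), and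
* `y₀ = (ρ − ϖ)y₁ + ϖ(y₁ − t₁) + (y₁^q − t₁^q)` (using `ϖt₁ + t₁^q = 0`), where the first term has norm exactly
  `δ‖t₁‖` and the other two have norm `≤ δ‖ϖ‖‖t₂‖ < δ‖t₁‖`;

hence **`‖y₀‖ = ‖ρ − ϖ‖·‖t₁‖`** (`norm_ltMap_ltMap_eq_of_norm_sub_le`). In particular `y₀ ≠ 0` as soon as `ρ ≠ ϖ`,
for every `q ≥ 2` — replacing the level-one lemma `ltMap_ne_zero_of_norm_sub_le` (`q ≥ 3`).

## §2 The theorem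

Exactly the proof of `lubinTateCharacterConjugateAdmissible_of_totallyRamified`, with Fontaine's elements
`x_t = c·x_{t⁺} + x_{t⁺}^q`, `x_{t⁺} = c·x_{t⁺⁺} + x_{t⁺⁺}^q` of the tower and its two shifts
(`AinfRamTop.coe_ltTorsionLift_eq_shift`), `yᵢ := θ_ρ(x_{t⁺ⁱ})`, `‖y₂ − t₂‖ ≤ ‖ρ − π‖`
(`AinfRamTop.norm_thetaConj_sub_theta_le`), the KEY step `y₀ ≠ 0` now read off from §1, and the same finish by Lang's
limit `u = λ_ρ(y₀)` (`LubinTateLangLimit`) and the quadratic orbit bound (`AinfRamTop.norm_ltMap_iterate_smul_sub_le`).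

No named facts, no `sorry`. Consumers: as for `LubinTateCharacterConjugatesTotallyRamified`
(`Summit.Langlands…SoloInformedDeRhamGL1TotallyRamified`, now for all `p`).

## References
* J.-P. Serre, *Abelian ℓ-adic representations and elliptic curves* (1968), Ch. III §A.5. [SerreAbelianLadic1968]
* P. Colmez, *Périodes des variétés abéliennes à multiplication complexe*, Ann. of Math. 138 (1993), §I.2. [Colmez1993]
* S. Lang, *Cyclotomic Fields I and II* (1990), Ch. 8 §6 Lemmas 1–3. [LangCyclotomic1990]
* J.-M. Fontaine, *Le corps des périodes p-adiques*, Astérisque 223 (1994), Exp. II §1.2.2. [FontaineAsterisque223III]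
* J. T. Tate, *p-divisible groups* (1967), §3.3. [Tate1967]
-/

noncomputable section

open Ideal Field WittVector ValuativeRel Filter
open _root_.Topology

namespace Literature.NumberTheory.PAdicHodge

open Literature.NumberTheory.GaloisRepresentations
open Literature.NumberTheory.GaloisRepresentations.IsNonarchimedeanLocalField
open Literature.NumberTheory.GaloisRepresentations.LubinTate

/-! ## §1 The level-two estimate in an ultrametric field -/

section LevelTwo

variable {K : Type*} [NormedField K] [IsUltrametricDist K]

/-- `‖a^{n+1} − b^{n+1}‖ ≤ ‖a − b‖ · max(‖a‖, ‖b‖)ⁿ` in an ultrametric field (from `a^{n+1} − b^{n+1} = (a − b)·Σ aⁱbⁿ⁻ⁱ`).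
[folklore] -/
private theorem ultrametric_norm_pow_succ_sub_pow_succ_le (a b : K) (n : ℕ) :
    ‖a ^ (n + 1) - b ^ (n + 1)‖ ≤ ‖a - b‖ * max ‖a‖ ‖b‖ ^ n := by
  have hS : ‖∑ i ∈ Finset.range (n + 1), a ^ i * b ^ (n + 1 - 1 - i)‖ ≤ max ‖a‖ ‖b‖ ^ n := by
    refine IsUltrametricDist.norm_sum_le_of_forall_le_of_nonneg
      (pow_nonneg (le_max_of_le_left (norm_nonneg _)) _) fun i hi => ?_
    rw [Finset.mem_range] at hi
    rw [norm_mul, norm_pow, norm_pow]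
    calc ‖a‖ ^ i * ‖b‖ ^ (n + 1 - 1 - i) ≤ max ‖a‖ ‖b‖ ^ i * max ‖a‖ ‖b‖ ^ (n + 1 - 1 - i) := by
          gcongr
          · exact le_max_left _ _
          · exact le_max_right _ _
      _ = max ‖a‖ ‖b‖ ^ n := by rw [← pow_add]; congr 1; omega
  rw [← geom_sum₂_mul, norm_mul]
  calc _ ≤ max ‖a‖ ‖b‖ ^ n * ‖a - b‖ := mul_le_mul_of_nonneg_right hS (norm_nonneg _)
    _ = _ := mul_comm _ _

/-- In an ultrametric normed field: `‖x − y‖ < ‖y‖` forces `‖x‖ = ‖y‖`. [folklore] -/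
private theorem norm_eq_of_norm_sub_lt' {x y : K} (h : ‖x - y‖ < ‖y‖) : ‖x‖ = ‖y‖ := by
  have h1 := IsUltrametricDist.norm_add_eq_max_of_norm_ne_norm (x := x - y) (y := y) h.ne
  rwa [sub_add_cancel, max_eq_right h.le] at h1

/-- **Level-two estimate.** In an ultrametric field let `q ≥ 2`, `‖ρ‖ = ‖ϖ‖ < 1`, and let `t₁ ≠ 0`, `t₂` be two layers
of a `ϖ`-division tower of `P = ϖX + X^q` (`ϖt₁ + t₁^q = 0`, `ϖt₂ + t₂^q = t₁`). If `‖y₂ − t₂‖ ≤ ‖ρ − ϖ‖`,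
`y₁ = ρy₂ + y₂^q` and `y₀ = ρy₁ + y₁^q`, then **`‖y₀‖ = ‖ρ − ϖ‖ · ‖t₁‖`**. (The dominant term of
`y₀ = (ρ − ϖ)y₁ + ϖ(y₁ − t₁) + (y₁^q − t₁^q)` is the first.) In particular `y₀ ≠ 0` whenever `ρ ≠ ϖ` — for every
`q ≥ 2`, unlike the level-one lemma `ltMap_ne_zero_of_norm_sub_le`.
[cite: SerreAbelianLadic1968, Ch. III §A.5] [cite: Colmez1993, §I.2] -/
theorem norm_ltMap_ltMap_eq_of_norm_sub_le {q : ℕ} (hq : 2 ≤ q) {ρ ϖ t₁ t₂ y₀ y₁ y₂ : K} (hρϖ : ‖ρ‖ = ‖ϖ‖)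
    (hϖ1 : ‖ϖ‖ < 1) (ht₁ : ϖ * t₁ + t₁ ^ q = 0) (ht₁0 : t₁ ≠ 0) (ht₂ : ϖ * t₂ + t₂ ^ q = t₁)
    (hy₁ : y₁ = ρ * y₂ + y₂ ^ q) (hy₀ : y₀ = ρ * y₁ + y₁ ^ q) (hy₂ : ‖y₂ - t₂‖ ≤ ‖ρ - ϖ‖) :
    ‖y₀‖ = ‖ρ - ϖ‖ * ‖t₁‖ := by
  obtain ⟨n, rfl⟩ : ∃ n, q = n + 1 := ⟨q - 1, by omega⟩
  have hn : n ≠ 0 := by omega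
  -- `‖ρ − ϖ‖ ≤ ‖ϖ‖`
  have hδ : ‖ρ - ϖ‖ ≤ ‖ϖ‖ := by
    have h := IsUltrametricDist.norm_add_le_max ρ (-ϖ)
    rwa [← sub_eq_add_neg, norm_neg, hρϖ, max_self] at h
  have ht₁pos : 0 < ‖t₁‖ := norm_pos_iff.2 ht₁0
  -- level one: `‖t₁‖ⁿ = ‖ϖ‖`, `‖t₁‖ < 1`
  have hnt₁ : ‖t₁‖ ^ n = ‖ϖ‖ := by
    have h : t₁ ^ (n + 1) = -(ϖ * t₁) := eq_neg_of_add_eq_zero_right ht₁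
    have h2 : ‖t₁‖ ^ n * ‖t₁‖ = ‖ϖ‖ * ‖t₁‖ := by rw [← pow_succ, ← norm_pow, h, norm_neg, norm_mul]
    exact mul_right_cancel₀ ht₁pos.ne' h2
  have hϖpos : 0 < ‖ϖ‖ := by rw [← hnt₁]; exact pow_pos ht₁pos _
  have ht₁1 : ‖t₁‖ < 1 := by
    by_contra hge
    rw [not_lt] at hge
    exact absurd ((one_le_pow₀ hge).trans_eq hnt₁) (not_le.2 hϖ1)
  -- level two: `t₂ ≠ 0`, the `X^q`-term dominates: `‖ϖ‖‖t₂‖ < ‖t₂‖^q = ‖t₁‖`, `‖ϖ‖ < ‖t₂‖ < 1`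
  have ht₂0 : t₂ ≠ 0 := by
    rintro rfl
    apply ht₁0
    rw [← ht₂, mul_zero, zero_pow (by omega), add_zero]
  have ht₂pos : 0 < ‖t₂‖ := norm_pos_iff.2 ht₂0
  have hdom : ‖ϖ‖ * ‖t₂‖ < ‖t₂‖ ^ (n + 1) := by
    by_contra hge
    rw [not_lt] at hge
    have h1 : ‖t₁‖ ≤ ‖ϖ‖ * ‖t₂‖ := by
      rw [← ht₂]
      refine (IsUltrametricDist.norm_add_le_max _ _).trans ?_
      rw [norm_mul, norm_pow]
      exact max_le le_rfl hge
    have h2 : ‖t₂‖ ^ n ≤ ‖t₁‖ ^ n := by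
      rw [hnt₁]
      have h3 : ‖t₂‖ ^ n * ‖t₂‖ ≤ ‖ϖ‖ * ‖t₂‖ := by rw [← pow_succ]; exact hge
      exact le_of_mul_le_mul_right h3 ht₂pos
    have h3 : ‖t₂‖ ≤ ‖t₁‖ := le_of_pow_le_pow_left₀ hn (norm_nonneg _) h2
    have h4 : ‖t₁‖ ≤ ‖ϖ‖ * ‖t₁‖ := h1.trans (mul_le_mul_of_nonneg_left h3 (norm_nonneg _))
    have h5 : ‖ϖ‖ * ‖t₁‖ < 1 * ‖t₁‖ := mul_lt_mul_of_pos_right hϖ1 ht₁pos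
    rw [one_mul] at h5
    exact absurd h4 (not_le.2 h5)
  have hnt₂ : ‖t₂‖ ^ (n + 1) = ‖t₁‖ := by
    have hne : ‖ϖ * t₂‖ ≠ ‖t₂ ^ (n + 1)‖ := by rw [norm_mul, norm_pow]; exact hdom.ne
    rw [← ht₂, IsUltrametricDist.norm_add_eq_max_of_norm_ne_norm hne, norm_mul, norm_pow, max_eq_right hdom.le]
  have ht₂1 : ‖t₂‖ < 1 := by
    by_contra hge
    rw [not_lt] at hge
    have h1 : (1 : ℝ) ≤ ‖t₂‖ ^ (n + 1) := one_le_pow₀ hge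
    rw [hnt₂] at h1
    exact absurd h1 (not_le.2 ht₁1)
  have ht₂n : ‖t₂‖ ^ n ≤ ‖t₂‖ := pow_le_of_le_one ht₂pos.le ht₂1.le hn
  have hϖt₂ : ‖ϖ‖ < ‖t₂‖ := by
    have h : ‖ϖ‖ * ‖t₂‖ < ‖t₂‖ ^ n * ‖t₂‖ := by rw [← pow_succ]; exact hdom
    exact (lt_of_mul_lt_mul_right h ht₂pos.le).trans_le ht₂n
  -- `‖y₂‖ = ‖t₂‖`
  have hny₂ : ‖y₂‖ = ‖t₂‖ := norm_eq_of_norm_sub_lt' ((hy₂.trans hδ).trans_lt hϖt₂)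
  -- `‖y₁ − t₁‖ ≤ ‖ρ − ϖ‖·‖t₂‖`, hence `‖y₁‖ = ‖t₁‖`
  have hd₁ : ‖y₁ - t₁‖ ≤ ‖ρ - ϖ‖ * ‖t₂‖ := by
    have hexp : y₁ - t₁ = (ρ - ϖ) * y₂ + (ϖ * (y₂ - t₂) + (y₂ ^ (n + 1) - t₂ ^ (n + 1))) := by
      rw [hy₁, ← ht₂]; ring
    rw [hexp]
    refine (IsUltrametricDist.norm_add_le_max _ _).trans (max_le ?_
      ((IsUltrametricDist.norm_add_le_max _ _).trans (max_le ?_ ?_)))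
    · rw [norm_mul, hny₂]
    · rw [norm_mul]
      calc ‖ϖ‖ * ‖y₂ - t₂‖ ≤ ‖t₂‖ * ‖ρ - ϖ‖ := mul_le_mul hϖt₂.le hy₂ (norm_nonneg _) (norm_nonneg _)
        _ = ‖ρ - ϖ‖ * ‖t₂‖ := mul_comm _ _
    · calc ‖y₂ ^ (n + 1) - t₂ ^ (n + 1)‖ ≤ ‖y₂ - t₂‖ * max ‖y₂‖ ‖t₂‖ ^ n :=
            ultrametric_norm_pow_succ_sub_pow_succ_le _ _ _
        _ = ‖y₂ - t₂‖ * ‖t₂‖ ^ n := by rw [hny₂, max_self]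
        _ ≤ ‖ρ - ϖ‖ * ‖t₂‖ := mul_le_mul hy₂ ht₂n (pow_nonneg (norm_nonneg _) _) (norm_nonneg _)
  have hny₁ : ‖y₁‖ = ‖t₁‖ :=
    norm_eq_of_norm_sub_lt' <|
      calc ‖y₁ - t₁‖ ≤ ‖ρ - ϖ‖ * ‖t₂‖ := hd₁
        _ ≤ ‖ϖ‖ * ‖t₂‖ := mul_le_mul_of_nonneg_right hδ (norm_nonneg _)
        _ < ‖t₂‖ ^ (n + 1) := hdom
        _ = ‖t₁‖ := hnt₂
  -- `y₀ = (ρ − ϖ)y₁ + ϖ(y₁ − t₁) + (y₁^q − t₁^q)`: dominant term + two small ones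
  have hexp₀ : y₀ = (ρ - ϖ) * y₁ + (ϖ * (y₁ - t₁) + (y₁ ^ (n + 1) - t₁ ^ (n + 1))) := by
    rw [hy₀]; linear_combination ht₁
  have hA : ‖(ρ - ϖ) * y₁‖ = ‖ρ - ϖ‖ * ‖t₁‖ := by rw [norm_mul, hny₁]
  have hBC : ‖ϖ * (y₁ - t₁) + (y₁ ^ (n + 1) - t₁ ^ (n + 1))‖ ≤ ‖ρ - ϖ‖ * (‖ϖ‖ * ‖t₂‖) := by
    refine (IsUltrametricDist.norm_add_le_max _ _).trans (max_le ?_ ?_)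
    · rw [norm_mul]
      calc ‖ϖ‖ * ‖y₁ - t₁‖ ≤ ‖ϖ‖ * (‖ρ - ϖ‖ * ‖t₂‖) := mul_le_mul_of_nonneg_left hd₁ (norm_nonneg _)
        _ = ‖ρ - ϖ‖ * (‖ϖ‖ * ‖t₂‖) := by ring
    · calc ‖y₁ ^ (n + 1) - t₁ ^ (n + 1)‖ ≤ ‖y₁ - t₁‖ * max ‖y₁‖ ‖t₁‖ ^ n :=
            ultrametric_norm_pow_succ_sub_pow_succ_le _ _ _
        _ = ‖y₁ - t₁‖ * ‖ϖ‖ := by rw [hny₁, max_self, hnt₁]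
        _ ≤ ‖ρ - ϖ‖ * ‖t₂‖ * ‖ϖ‖ := mul_le_mul_of_nonneg_right hd₁ (norm_nonneg _)
        _ = ‖ρ - ϖ‖ * (‖ϖ‖ * ‖t₂‖) := by ring
  rcases eq_or_ne ρ ϖ with hρeq | hne
  · -- `ρ = ϖ`: then `y₂ = t₂`, `y₁ = t₁`, `y₀ = 0`
    rw [hρeq, sub_self, norm_zero, norm_le_zero_iff, sub_eq_zero] at hy₂
    rw [hρeq, hy₂, ht₂] at hy₁
    rw [hρeq, hy₁, ht₁] at hy₀
    rw [hy₀, hρeq, sub_self, norm_zero, zero_mul]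
  · have hδpos : 0 < ‖ρ - ϖ‖ := norm_pos_iff.2 (sub_ne_zero.2 hne)
    have hlt : ‖ϖ * (y₁ - t₁) + (y₁ ^ (n + 1) - t₁ ^ (n + 1))‖ < ‖(ρ - ϖ) * y₁‖ := by
      rw [hA]
      exact hBC.trans_lt (mul_lt_mul_of_pos_left (hdom.trans_eq hnt₂) hδpos)
    rw [hexp₀, IsUltrametricDist.norm_add_eq_max_of_norm_ne_norm hlt.ne', max_eq_left hlt.le, hA]

end LevelTwo

/-! ## §2 ★★ Hypothesis (H) for totally ramified `F`, every `p` -/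

variable {F : Type} [Field F] [ValuativeRel F] [TopologicalSpace F] [IsNonarchimedeanLocalField F] [CharZero F]
variable {p : ℕ} [Fact p.Prime] {hp : valuation F p < 1}

/-- ★★ **Hypothesis (H) of the Lubin–Tate character files for every totally ramified `F/ℚ_p` and EVERY prime `p`**:
for an Eisenstein datum `D` of `F` with `D.root = π` a uniformizer and `[F : ℚ_p] = deg f` (so `#k_F = p`), every
`ℚ_p`-embedding `e ≠ id` of `F` admits `u ∈ ℂ_F`, `u ≠ 0`, with `σ(u) = e(χ_π σ)·u` for all `σ ∈ Γ_M` (`M ⊇ e'(F)` for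
all `e'`) — `u = λ_ρ(θ_ρ(x_t))`, Lang's limit of the conjugate specialisation of Fontaine's element of the
`π`-division tower; `θ_ρ(x_t) ≠ 0` by the level-two estimate `‖θ_ρ(x_t)‖ = ‖ρ − π‖·‖t₁‖`
(`norm_ltMap_ltMap_eq_of_norm_sub_le`), valid for every `q = p ≥ 2`. Supersedes
`lubinTateCharacterConjugateAdmissible_of_totallyRamified` (`p ≥ 3`).
[cite: SerreAbelianLadic1968, Ch. III §A.5] [cite: Colmez1993, §I.2] [cite: LangCyclotomic1990, Ch. 8 §6]
[cite: FontaineAsterisque223III, Exp. II §1.2.2] -/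
theorem lubinTateCharacterConjugateAdmissible_of_finrank_eq (D : EisensteinRoot F p hp) {π : 𝒪[F]}
    (hπ : (valuation F).IsUniformizer (π : F)) (hπD : (π : F) = D.root) (hk : residueFieldCard F = p)
    (hd : Module.finrank (PadicBase F p hp) F = D.e) :
    LubinTateCharacterConjugateAdmissible F p hp hπ := by
  intro M _ hM e he
  haveI : Fact (¬ IsUnit (p : integerC F)) := ⟨not_isUnit_natCast_integerC hp⟩
  haveI := isAdicComplete_integerC_natCast (F := F) hp
  have hθ : Function.Surjective (fontaineTheta (integerC F) p) := surjective_fontaineTheta_integerC hp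
  have hpq : p ∣ residueFieldCard F := hk ▸ dvd_rfl
  have hq2 : 2 ≤ residueFieldCard F := one_lt_residueFieldCard F
  have hA : IsLTRing (EisensteinRoot.CoeffDisc.of D (AdjoinRoot.root D.poly)) (residueFieldCard F) := by
    rw [hk]; simpa using D.isLTRing_coeffDisc 1
  have hf : IsLTSeries (EisensteinRoot.CoeffDisc.of D (AdjoinRoot.root D.poly)) (residueFieldCard F)
      (ltSeries (EisensteinRoot.CoeffDisc.of D (AdjoinRoot.root D.poly)) (residueFieldCard F)) :=
    isLTSeries_ltSeries _ (one_lt_residueFieldCard F)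
  have htp := EisensteinRoot.ltStepC_ltDivTower_succ D hπ hπD
  have htp' := AinfRamTop.ltStepC_shift htp 1
  -- the conjugate root `ρ = e(π)` of `f`
  have hρ : D.poly.eval₂ ((algebraMap F (CompletedAlgClosure F)).comp (zpToF hp))
      ((e D.root : NormedAlgClosure F) : CompletedAlgClosure F) = 0 := D.isRoot_embedding e
  have hϖ1 : ‖algebraMap F (CompletedAlgClosure F) D.root‖ < 1 := D.norm_algebraMap_root_lt_one
  have hρϖ : ‖((e D.root : NormedAlgClosure F) : CompletedAlgClosure F)‖ = ‖algebraMap F (CompletedAlgClosure F) D.root‖ :=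
    D.norm_eq_norm_root_of_isRoot hρ
  have hne : ((e D.root : NormedAlgClosure F) : CompletedAlgClosure F) ≠ algebraMap F (CompletedAlgClosure F) D.root :=
    fun h => D.embedding_root_ne hd e he
      (UniformSpace.Completion.coe_injective (NormedAlgClosure F) (h.trans (CompletedAlgClosure.algebraMap_eq_coe _)))
  have hϖ0 : algebraMap F (CompletedAlgClosure F) D.root ≠ 0 := by
    intro h
    have h1 := D.norm_algebraMap_root_pow
    rw [h, norm_zero, zero_pow D.e_pos.ne'] at h1
    exact natCast_C_ne_zero (Fact.out : p.Prime).ne_zero (norm_eq_zero.1 h1.symm)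
  have hρ0 : ((e D.root : NormedAlgClosure F) : CompletedAlgClosure F) ≠ 0 := by
    rw [← norm_pos_iff, hρϖ, norm_pos_iff]; exact hϖ0
  have hρ1 : ‖((e D.root : NormedAlgClosure F) : CompletedAlgClosure F)‖ < 1 := hρϖ ▸ hϖ1
  -- `θ_ρ(c) = ρ` for the coefficient `c = ϖ_D`
  have hκc : ((AinfRamTop.thetaConj D hρ (algebraMap (EisensteinRoot.CoeffDisc D) (AinfRamTop D)
      (EisensteinRoot.CoeffDisc.of D (AdjoinRoot.root D.poly))) : CBall F) : CompletedAlgClosure F) =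
      ((e D.root : NormedAlgClosure F) : CompletedAlgClosure F) :=
    AinfRamTop.coe_thetaConj_algebraMap_varpiDisc D e
  -- Fontaine's elements `x_t`, `x_{t⁺}`, `x_{t⁺⁺}` and their conjugate images `y₀`, `y₁`, `y₂`
  set x₀ : AinfRamTop D := AinfRamTop.ltTorsionLift (EisensteinRoot.CoeffDisc.of D (AdjoinRoot.root D.poly))
      (residueFieldCard_ne_zero F) hpq (k := D.e) AinfRamTop.algebraMap_varpiDisc_pow_mem_ideal hθ (ltDivTower hπ) htp
    with hx₀def
  set x₁ : AinfRamTop D := AinfRamTop.ltTorsionLift (EisensteinRoot.CoeffDisc.of D (AdjoinRoot.root D.poly))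
      (residueFieldCard_ne_zero F) hpq (k := D.e) AinfRamTop.algebraMap_varpiDisc_pow_mem_ideal hθ
      (fun m => ltDivTower hπ (m + 1)) htp' with hx₁def
  set x₂ : AinfRamTop D := AinfRamTop.ltTorsionLift (EisensteinRoot.CoeffDisc.of D (AdjoinRoot.root D.poly))
      (residueFieldCard_ne_zero F) hpq (k := D.e) AinfRamTop.algebraMap_varpiDisc_pow_mem_ideal hθ
      (fun m => ltDivTower hπ (m + 1 + 1))
      (AinfRamTop.ltStepC_shift (t := fun m => ltDivTower hπ (m + 1)) htp' 1) with hx₂def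
  have hx₀mem : x₀ ∈ (AinfRamTop.nilTheta D hθ).toIdeal := by
    rw [hx₀def]; exact AinfRamTop.ltTorsionLift_mem_nilTheta hpq _ htp
  -- `θ_𝒪(x_{t⁺⁺}) = t₂`, `x_t = c·x_{t⁺} + x_{t⁺}^q`, `x_{t⁺} = c·x_{t⁺⁺} + x_{t⁺⁺}^q`
  have hθx₂ : AinfRamTop.theta D x₂ = ((ltDivTower hπ (1 + 1) : (maxNilIdealC F).toIdeal) : CBall F) := by
    rw [hx₂def, AinfRamTop.theta_ltTorsionLift_shift (t := fun m => ltDivTower hπ (m + 1)) hpq _ htp']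
  have hx₀₁ : x₀ = algebraMap (EisensteinRoot.CoeffDisc D) (AinfRamTop D)
      (EisensteinRoot.CoeffDisc.of D (AdjoinRoot.root D.poly)) * x₁ + x₁ ^ residueFieldCard F := by
    rw [hx₀def, hx₁def]; exact AinfRamTop.coe_ltTorsionLift_eq_shift hpq _ htp
  have hx₁₂ : x₁ = algebraMap (EisensteinRoot.CoeffDisc D) (AinfRamTop D)
      (EisensteinRoot.CoeffDisc.of D (AdjoinRoot.root D.poly)) * x₂ + x₂ ^ residueFieldCard F := by
    rw [hx₁def, hx₂def]
    exact AinfRamTop.coe_ltTorsionLift_eq_shift (t := fun m => ltDivTower hπ (m + 1)) hpq _ htp'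
  -- `y₀ = θ_ρ(x_t)`, `y₁ = θ_ρ(x_{t⁺})`, `y₂ = θ_ρ(x_{t⁺⁺})`: `‖y₂ − t₂‖ ≤ ‖ρ − ϖ‖`, `y₀ = ρ y₁ + y₁^q`,
  -- `y₁ = ρ y₂ + y₂^q`
  have hy₂le : ‖((AinfRamTop.thetaConj D hρ x₂ : CBall F) : CompletedAlgClosure F) -
      (((ltDivTower hπ (1 + 1) : (maxNilIdealC F).toIdeal) : CBall F) : CompletedAlgClosure F)‖ ≤
      ‖((e D.root : NormedAlgClosure F) : CompletedAlgClosure F) - algebraMap F (CompletedAlgClosure F) D.root‖ := by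
    have h := AinfRamTop.norm_thetaConj_sub_theta_le D hρ x₂
    rwa [hθx₂] at h
  have hy₀₁ : ((AinfRamTop.thetaConj D hρ x₀ : CBall F) : CompletedAlgClosure F) =
      ((e D.root : NormedAlgClosure F) : CompletedAlgClosure F) *
          ((AinfRamTop.thetaConj D hρ x₁ : CBall F) : CompletedAlgClosure F) +
        ((AinfRamTop.thetaConj D hρ x₁ : CBall F) : CompletedAlgClosure F) ^ residueFieldCard F := by
    rw [hx₀₁, map_add, map_mul, map_pow, Subring.coe_add, Subring.coe_mul, SubmonoidClass.coe_pow, hκc]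
  have hy₁₂ : ((AinfRamTop.thetaConj D hρ x₁ : CBall F) : CompletedAlgClosure F) =
      ((e D.root : NormedAlgClosure F) : CompletedAlgClosure F) *
          ((AinfRamTop.thetaConj D hρ x₂ : CBall F) : CompletedAlgClosure F) +
        ((AinfRamTop.thetaConj D hρ x₂ : CBall F) : CompletedAlgClosure F) ^ residueFieldCard F := by
    rw [hx₁₂, map_add, map_mul, map_pow, Subring.coe_add, Subring.coe_mul, SubmonoidClass.coe_pow, hκc]
  -- the tower relations `ϖ t₁ + t₁^q = 0`, `t₁ ≠ 0`, `‖t₁‖ < 1`, `ϖ t₂ + t₂^q = t₁`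
  have ht₁ : algebraMap F (CompletedAlgClosure F) D.root *
        (((ltDivTower hπ 1 : (maxNilIdealC F).toIdeal) : CBall F) : CompletedAlgClosure F) +
      (((ltDivTower hπ 1 : (maxNilIdealC F).toIdeal) : CBall F) : CompletedAlgClosure F) ^ residueFieldCard F = 0 := by
    have h := ltPoly_ltDivTower_succ hπ 0
    rwa [zero_add, hπD, coe_ltDivTower_zero, Subring.coe_zero] at h
  have ht₁0 : (((ltDivTower hπ 1 : (maxNilIdealC F).toIdeal) : CBall F) : CompletedAlgClosure F) ≠ 0 :=
    fun h => ltDivTower_one_ne_zero hπ (ZeroMemClass.coe_eq_zero.1 h)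
  have ht₁1 : ‖(((ltDivTower hπ 1 : (maxNilIdealC F).toIdeal) : CBall F) : CompletedAlgClosure F)‖ < 1 :=
    (ltDivTower hπ 1).2
  have ht₂ : algebraMap F (CompletedAlgClosure F) D.root *
        (((ltDivTower hπ (1 + 1) : (maxNilIdealC F).toIdeal) : CBall F) : CompletedAlgClosure F) +
      (((ltDivTower hπ (1 + 1) : (maxNilIdealC F).toIdeal) : CBall F) : CompletedAlgClosure F) ^ residueFieldCard F =
      (((ltDivTower hπ 1 : (maxNilIdealC F).toIdeal) : CBall F) : CompletedAlgClosure F) := by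
    have h := ltPoly_ltDivTower_succ hπ 1
    rwa [hπD] at h
  -- KEY (level-two estimate): `‖y₀‖ = ‖ρ − ϖ‖·‖t₁‖`, so `y₀ ≠ 0`, and the convergence regime `‖y₀‖^{q-1} < ‖ρ‖`
  have hy₀norm := norm_ltMap_ltMap_eq_of_norm_sub_le hq2 hρϖ hϖ1 ht₁ ht₁0 ht₂ hy₁₂ hy₀₁ hy₂le
  have hy₀0 : ((AinfRamTop.thetaConj D hρ x₀ : CBall F) : CompletedAlgClosure F) ≠ 0 := by
    rw [← norm_pos_iff, hy₀norm]
    exact mul_pos (norm_pos_iff.2 (sub_ne_zero.2 hne)) (norm_pos_iff.2 ht₁0)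
  have hy₀reg : ‖((AinfRamTop.thetaConj D hρ x₀ : CBall F) : CompletedAlgClosure F)‖ ^ (residueFieldCard F - 1) <
      ‖((e D.root : NormedAlgClosure F) : CompletedAlgClosure F)‖ := by
    have hδρ : ‖((e D.root : NormedAlgClosure F) : CompletedAlgClosure F) - algebraMap F (CompletedAlgClosure F) D.root‖
        ≤ ‖((e D.root : NormedAlgClosure F) : CompletedAlgClosure F)‖ := by
      have h := IsUltrametricDist.norm_add_le_max ((e D.root : NormedAlgClosure F) : CompletedAlgClosure F)
        (-algebraMap F (CompletedAlgClosure F) D.root)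
      rwa [← sub_eq_add_neg, norm_neg, ← hρϖ, max_self] at h
    have h1 : ‖((AinfRamTop.thetaConj D hρ x₀ : CBall F) : CompletedAlgClosure F)‖ <
        ‖((e D.root : NormedAlgClosure F) : CompletedAlgClosure F)‖ := by
      rw [hy₀norm]
      calc _ ≤ ‖((e D.root : NormedAlgClosure F) : CompletedAlgClosure F)‖ *
              ‖(((ltDivTower hπ 1 : (maxNilIdealC F).toIdeal) : CBall F) : CompletedAlgClosure F)‖ :=
            mul_le_mul_of_nonneg_right hδρ (norm_nonneg _)
        _ < ‖((e D.root : NormedAlgClosure F) : CompletedAlgClosure F)‖ * 1 :=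
            mul_lt_mul_of_pos_left ht₁1 (norm_pos_iff.2 hρ0)
        _ = _ := mul_one _
    calc _ ≤ ‖((AinfRamTop.thetaConj D hρ x₀ : CBall F) : CompletedAlgClosure F)‖ :=
          pow_le_of_le_one (norm_nonneg _) (h1.le.trans hρ1.le) (by omega)
      _ < _ := h1
  -- the eigenvector `u = λ_ρ(y₀)`
  refine ⟨LangLimit.langLog ((e D.root : NormedAlgClosure F) : CompletedAlgClosure F) (residueFieldCard F)
      ((AinfRamTop.thetaConj D hρ x₀ : CBall F) : CompletedAlgClosure F),
    LangLimit.langLog_ne_zero hq2 hρ0 hρ1 hy₀reg hy₀0, fun σ hσM => ?_⟩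
  -- `σ` fixes `ρ = e(π) ∈ M`
  have hσρ : σ • ((e D.root : NormedAlgClosure F) : CompletedAlgClosure F) =
      ((e D.root : NormedAlgClosure F) : CompletedAlgClosure F) := by
    rw [CompletedAlgClosure.smul_coe, hσM _ (hM e D.root)]
  -- `σ x_t = [a]_P x_t` with `a ↦ χ_π(σ)` under `𝒪_D → 𝒪_F`, and `θ_ρ(a) = e(χ_π σ)`
  obtain ⟨a, ha⟩ := EisensteinRoot.CoeffDisc.exists_toInt_eq_lubinTateChar D hπD hk hπ σ
  have hX : AinfRamTop.gal D σ ((⟨x₀, hx₀mem⟩ : (AinfRamTop.nilTheta D hθ).toIdeal) : AinfRamTop D) =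
      (ltSMul (AinfRamTop.nilTheta D hθ) hA hf a ⟨x₀, hx₀mem⟩ : AinfRamTop D) :=
    AinfRamTop.gal_ltTorsionLift_of_galSeq_eq (hθ := hθ) hA hf hpq AinfRamTop.algebraMap_varpiDisc_pow_mem_ideal σ a
      htp (EisensteinRoot.galSeq_ltDivTower D hπ hπD hA hf σ ha)
  have hκ : ((AinfRamTop.thetaConj D hρ (algebraMap (EisensteinRoot.CoeffDisc D) (AinfRamTop D) a) : CBall F) :
        CompletedAlgClosure F) =
      ((e ((lubinTateChar hπ σ : 𝒪[F]) : F) : NormedAlgClosure F) : CompletedAlgClosure F) := by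
    have ha' : a = EisensteinRoot.CoeffDisc.of D ((EisensteinRoot.CoeffDisc.of D).symm a) :=
      ((EisensteinRoot.CoeffDisc.of D).apply_symm_apply a).symm
    rw [← ha, ha', AinfRamTop.coe_thetaConj_algebraMap_coeffDisc, ← EisensteinRoot.CoeffDisc.coe_toInt]
  -- the quadratic bound along the orbit, linearised by Lang's limit
  have hbound := AinfRamTop.norm_ltMap_iterate_smul_sub_le D hA hf hρ σ hσρ a hX
  simp only [hκc] at hbound
  rw [CompletedAlgClosure.smul_def, LangLimit.map_langLog hq2 hρ0 hρ1 hy₀reg (CompletedAlgClosure.galRingHom σ)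
      (CompletedAlgClosure.continuous_galRingHom σ) (by rw [← CompletedAlgClosure.smul_def, hσρ])
      (by rw [← CompletedAlgClosure.smul_def, CompletedAlgClosure.norm_smul]),
    ← CompletedAlgClosure.smul_def, ← hκ]
  exact LangLimit.langLog_eq_mul hq2 hρ0 hρ1 hy₀reg (AinfRamTop.norm_thetaConj_le_one D hρ _) hbound

end Literature.NumberTheory.PAdicHodge

end
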